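import Summits.BirchSwinnertonDyer.BirchSwinnertonDyer.Theorems.PrintX11aLowerHalfNonSurjDoors
import Summits.BirchSwinnertonDyer.BirchSwinnertonDyer.Theorems.PrintX11aEulerHalfGlue
import HarnessLib

/-!
# Crux `X11aLowerHalf` (item stmt-BirchSwinnertonDyer-19064) at `p ≥ 5`, BOTH image types: the lower half
# from the per-pair certificate `μ^an(E,p) = 0` and named facts — the two registered stubs of line birth r1
# (`stub_lowerSurjDeep` ∣ `stub_lowerNonSurjDeep`) have ONE residual object at `p ≥ 5`
# (`--supports stmt-BirchSwinnertonDyer-19064` helper; seat bsd-line-er5-p2 = -w3 width seat of the 19064 line)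

HONEST FRAMING. Theorems only; no definition, no named fact, no `sorry`; NO route file imported (citable from a
route's `closes`). Nothing here closes the crux or a stub: every theorem is CONDITIONAL on displayed named facts
and on `∀`-certificate hypotheses (`μ^an = 0` on the deep X11a pairs at `p ≥ 5` — Greenberg's `μ`-conjecture
there, barrier B3, OPEN class-wide) and, for the whole crux, on the `p = 3` part (OPEN). BSD is not proved for
any curve or class by this file. beyond-print theorem: no.

## What

* `x11aLowerHalf_five_of_forall_muAnZeroAt_of_facts` — **the body of `X11aLowerHalf` RESTRICTED TO `p ≥ 5`
  ⟸ 17 named facts + Greenberg–Stevens + ONE `∀`-certificate hypothesis** (`∀` X11a pairs with `p ≥ 5` and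
  `#Ш_an` not a `p`-adic unit, `X11a.MuAnZeroAt W p`): unit pairs are free
  (`x11a_missingLowerBoundAt_of_shaAnUnit`); on the SURJECTIVE sub-leaf the x11a chain of record
  `X11a.forall_bsdp_of_namedFacts_ofLevel_heightFree` (with Wan Thm. 4 fed from its (irred) instance via
  `NonSurjChain.thm4_irred_to_ofLevel`) + `ClassX11a.missingLowerBoundAt_of_bsdp`; on the NON-surjective
  sub-leaf `ClassX11a.missingLowerBoundAt_of_muAnZeroAt_of_not_surj_of_facts` (p609759).
* `x11aLowerHalf_body_of_three_of_forall_muAnZeroAt_of_facts` — **the WHOLE crux body** (`∀ W p, ClassX11a W p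
  → MissingLowerBoundAt W p`, i.e. `Theses.ErratumRoadFive.X11aLowerHalf` ∕ `Theses.PrintX11a.X11aLowerHalf`
  unfolded — `Iff.rfl` for an importer of either route file) ⟸ the same facts + the `∀`-certificate at `p ≥ 5`
  + the `p = 3` off-unit part (`∀` X11a pairs with `p = 3`, `#Ш_an` not a `3`-adic unit: the lower half —
  OPEN; the x11a three-descent ∕ Wuthrich records serve it per pair).
READING (for the line's lead and the ER5 ∕ PrintX11a planners, their call): at `p ≥ 5` the crux is, modulo
print, the μ-certificate statement — the SAME residual as crux U `X11aNonSurjEulerHalf` (20406 ∕ 20614) on the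
non-surjective sub-leaf and as item 19948 `NonSurjCornerTwinMuAn`'s body; route ErratumRoadFive («BSD(E,p) on
X11b at p ≥ 5») consumes `X11aLowerHalf` only at `p ≥ 5`, so its binder h₃ could be re-typed to the `p ≥ 5`
restriction or to the μ-certificate statement with this file's first theorem as glue.

References: [EmertonPollackWeston2006] Thm. 1, 3.1.1, 5.1.3; [Wan2015] Thm. 4 = Thm. 103; [Kato2004Asterisque]
Thm. 12.4, §17.13; [Wuthrich2014] Thm. 3, Cor. 18; [SteinWuthrich2013] Thm. 6.1; [GreenbergLNM1716] Conj. 1.11;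
[Miller2011LMS] Def. 1.1; cell files `pub/bsd-print-x11a/P3-EXCEPTIONAL-ZERO-ROAD.md`, `pub/bsd-stepL/line-er5-p2/`.
-/

set_option autoImplicit false
set_option linter.dupNamespace false -- the directory name repeats the summit name (sibling precedent)

noncomputable section

open scoped Classical MatrixGroups ModularForm

open CongruenceSubgroup WeierstrassCurve Literature.NumberTheory.EllipticCurves
  Literature.NumberTheory.EllipticCurves.ModularForms
  Literature.NumberTheory.EllipticCurves.Rank1Residual
  Literature.NumberTheory.EllipticCurves.Rank1Residual.Typed
  Literature.NumberTheory.EllipticCurves.Wuthrich2014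
  Literature.NumberTheory.EllipticCurves.SteinWuthrich2013
  Literature.NumberTheory.EllipticCurves.Greenberg1999
  Literature.NumberTheory.EllipticCurves.Kato2004
  Literature.NumberTheory.EllipticCurves.GreenbergVatsal2000
  Literature.NumberTheory.EllipticCurves.EmertonPollackWeston2006
  Summit.BirchSwinnertonDyer.Rank1Residual
  Summit.BirchSwinnertonDyer.Rank1Residual.X11a

namespace Summit.BirchSwinnertonDyer.BirchSwinnertonDyer.Theorems.NonSurjChain

/-- **The body of crux `X11aLowerHalf` RESTRICTED TO `p ≥ 5`, from 17 named facts + Greenberg–Stevens + the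
`∀`-certificate `μ^an = 0` on the deep X11a pairs at `p ≥ 5` (both image types).** Displayed facts: modularity
(`hNf`), EPW 2006 Thm. 3.1.1 ∕ Thm. 1 ∕ Thm. 5.1.3 at any tame level (`h311`, `hT1a`, `hT1b`), Wan 2015 Thm. 4
rational part under (irred) (`hT2`; its Surj instance is derived, `thm4_irred_to_ofLevel`), Deligne–Serre 6.1
(`h61`), Hida/Wiles 3.26 (`h326`), Kato–Wuthrich A32 (`hKato`, surjective sub-leaf), Kato 2004 Thm. 12.4 +
§17.13 ×3 + Greenberg 1999 Thm. 1.5 + Wuthrich 2014 Cor. 18 (`h12`, `hns`, `hsp`, `h15`, `h18`, `hfine`,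
non-surjective sub-leaf), Stein–Wuthrich 2013 Thm. 6.1 ×2 (`hJs`, `hJn`), GZK (`hGZK`), Greenberg–Stevens
(`hGS`). CONDITIONAL; the certificate hypothesis is Greenberg's `μ`-conjecture on that locus (OPEN); closes
nothing by itself. [cite: EmertonPollackWeston2006, Thm. 1, Thm. 3.1.1, Thm. 5.1.3] [cite: Wan2015, Thm. 4 (pp. 4–5)]
[cite: Wuthrich2014, Thm. 3 (p. 382) and Cor. 18 (p. 398)] [cite: Kato2004Asterisque, §17.13 (pp. 279–280)]
[cite: GreenbergLNM1716, Conj. 1.11 (shape)] [cite: Miller2011LMS, §1 and Def. 1.1] -/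
theorem x11aLowerHalf_five_of_forall_muAnZeroAt_of_facts
    (hNf : exists_isNewformOf)
    (h311 : thm311_cotorsion_weightK_member_ofLevel) (hT1a : thm1_muAlg_of_weightK_member_ofLevel)
    (hT2 : Wan2015.thm4_rational_weightK_member_of_bdd_ofLevel_irred)
    (hT1b : thm513_transfer_from_weightK_member_of_bdd_ofLevel)
    (h61 : DeligneSerre1974.thm61_exists_adicGaloisRep) (h326 : Hida2000_thm326_ordinary)
    (hKato : kato_charIdeal_dvd_multiplicative_of_surjective)
    (h12 : Kato2004.thm12_4)
    (hns : Kato2004.exists_multDivisibilityInputs_nonsplit)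
    (hsp : Kato2004.exists_multDivisibilityInputs_split)
    (h15 : thm15_isTorsion_multiplicative_rat)
    (h18 : Wuthrich2014.corollary18_padicLFunction_mem_iwasawaAlgebra_multiplicative)
    (hfine : Kato2004.exists_multDivisibilityInputs_fine)
    (hJs : thm61_splitMultiplicative) (hJn : thm61_nonsplitMultiplicative)
    (hGZK : rank_eq_analyticRank_of_analyticRank_le_one)
    (hGS : ∀ (W : WeierstrassCurve ℚ) [W.IsElliptic] [W.IsGloballyMinimal] (p : ℕ) [Fact p.Prime],
      greenberg_stevens (W := W) (p := p))
    (hcert : ∀ (W : WeierstrassCurve ℚ) [W.IsElliptic] [W.IsGloballyMinimal] (p : ℕ) [Fact p.Prime],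
      ClassX11a W p → 5 ≤ p → ¬ X11a.ShaAnUnit W p → X11a.MuAnZeroAt W p) :
    ∀ (W : WeierstrassCurve ℚ) [W.IsElliptic] [W.IsGloballyMinimal] (p : ℕ) [Fact p.Prime],
      ClassX11a W p → 5 ≤ p → MissingLowerBoundAt W p := by
  intro W _ _ p _ hX hp
  by_cases hu : X11a.ShaAnUnit W p
  · exact x11a_missingLowerBoundAt_of_shaAnUnit hu
  have hμ : X11a.MuAnZeroAt W p := hcert W p hX hp hu
  by_cases hsurj : Surj W p
  · exact hX.missingLowerBoundAt_of_bsdp hGZK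
      (forall_bsdp_of_namedFacts_ofLevel_heightFree hNf h311 hT1a (thm4_irred_to_ofLevel hT2) hT1b h61 h326
        hKato hJs hJn hGZK hGS W p hX hp hsurj hμ)
  · exact hX.missingLowerBoundAt_of_muAnZeroAt_of_not_surj_of_facts hNf h311 hT1a hT2 hT1b h61 h326 h12 hns
      hsp h15 h18 hfine hJs hJn hGZK (hGS W p) hsurj hp hμ

/-- **The WHOLE body of crux `X11aLowerHalf`** (`∀` X11a pairs, the lower half — literally the unfolding of
`Theses.ErratumRoadFive.X11aLowerHalf` = `Theses.PrintX11a.X11aLowerHalf`; no route file is imported here)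
**⟸ the 17 facts + Greenberg–Stevens + the `∀`-certificate at `p ≥ 5` + the `p = 3` off-unit part** (the
lower half at the X11a pairs with `p = 3` and `#Ш_an` not a `3`-adic unit — OPEN class-wide; images
`GL₂(𝔽₃)` ∕ `3Ns` ∕ `3Nn`; no EPW ∕ Wan chain is typed at `p = 3`). `p` is an odd prime on X11a
(`ClassX11a.ne_two`), so `p = 3 ∨ 5 ≤ p`. CONDITIONAL; closes nothing by itself.
[cite: GreenbergLNM1716, Conj. 1.11 (shape)] [cite: Miller2011LMS, §1 and Def. 1.1]
[cite: EmertonPollackWeston2006, Thm. 5.1.3] [cite: Wan2015, Thm. 4 (pp. 4–5)] -/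
theorem x11aLowerHalf_body_of_three_of_forall_muAnZeroAt_of_facts
    (hNf : exists_isNewformOf)
    (h311 : thm311_cotorsion_weightK_member_ofLevel) (hT1a : thm1_muAlg_of_weightK_member_ofLevel)
    (hT2 : Wan2015.thm4_rational_weightK_member_of_bdd_ofLevel_irred)
    (hT1b : thm513_transfer_from_weightK_member_of_bdd_ofLevel)
    (h61 : DeligneSerre1974.thm61_exists_adicGaloisRep) (h326 : Hida2000_thm326_ordinary)
    (hKato : kato_charIdeal_dvd_multiplicative_of_surjective)
    (h12 : Kato2004.thm12_4)
    (hns : Kato2004.exists_multDivisibilityInputs_nonsplit)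
    (hsp : Kato2004.exists_multDivisibilityInputs_split)
    (h15 : thm15_isTorsion_multiplicative_rat)
    (h18 : Wuthrich2014.corollary18_padicLFunction_mem_iwasawaAlgebra_multiplicative)
    (hfine : Kato2004.exists_multDivisibilityInputs_fine)
    (hJs : thm61_splitMultiplicative) (hJn : thm61_nonsplitMultiplicative)
    (hGZK : rank_eq_analyticRank_of_analyticRank_le_one)
    (hGS : ∀ (W : WeierstrassCurve ℚ) [W.IsElliptic] [W.IsGloballyMinimal] (p : ℕ) [Fact p.Prime],
      greenberg_stevens (W := W) (p := p))
    (h3 : ∀ (W : WeierstrassCurve ℚ) [W.IsElliptic] [W.IsGloballyMinimal] (p : ℕ) [Fact p.Prime],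
      ClassX11a W p → p = 3 → ¬ X11a.ShaAnUnit W p → MissingLowerBoundAt W p)
    (hcert : ∀ (W : WeierstrassCurve ℚ) [W.IsElliptic] [W.IsGloballyMinimal] (p : ℕ) [Fact p.Prime],
      ClassX11a W p → 5 ≤ p → ¬ X11a.ShaAnUnit W p → X11a.MuAnZeroAt W p) :
    ∀ (W : WeierstrassCurve ℚ) [W.IsElliptic] [W.IsGloballyMinimal] (p : ℕ) [Fact p.Prime],
      ClassX11a W p → MissingLowerBoundAt W p := by
  intro W _ _ p hpF hX
  have hprime : p.Prime := hpF.out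
  have hp2 : p ≠ 2 := hX.ne_two
  by_cases hu : X11a.ShaAnUnit W p
  · exact x11a_missingLowerBoundAt_of_shaAnUnit hu
  rcases Nat.lt_or_ge p 5 with hlt | hge
  · -- `p` prime, `p ≠ 2`, `p < 5` ⟹ `p = 3`
    have hp3 : p = 3 := by
      have h2le := hprime.two_le
      interval_cases p
      · exact absurd rfl hp2
      · rfl
      · exact absurd hprime (by decide)
    exact h3 W p hX hp3 hu
  · exact x11aLowerHalf_five_of_forall_muAnZeroAt_of_facts hNf h311 hT1a hT2 hT1b h61 h326 hKato h12 hns hsp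
      h15 h18 hfine hJs hJn hGZK hGS hcert W p hX hge

end Summit.BirchSwinnertonDyer.BirchSwinnertonDyer.Theorems.NonSurjChain

end
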